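/- Free-seat work of EXTRA WIDTH SEAT `ym-line-cbag-p1-w5` (prover-ym-line-cbag-p1-w5-g3-0), route `EguchiKawaiDirectionLadder`
(ideator ym-idea-2, LINE 8), crux `TripleSmallBallMargin` (stmt-QuantumFields-27724), v7 S10-B glue: the two-link Eguchi–Kawai
measure `ekHaar 2 n` versus the Haar PAIR measure `Haar ⊗ Haar` on `U(n) × U(n)`, for ARBITRARY events.  The one-level decoupling
inequality (S9, `haar_prod_le_prod_robustPair_mul`) asks for its rank-robust pair small-ball input in the pair form
`(Haar ⊗ Haar){(P₁,P₂) | ∃ L, rank L ≤ r ∧ ‖P₁P₂ − P₂P₁ − L‖_F² ≤ σ}`, while the S8 reduction (`RankRobust.ekHaar_two_rankRobust_le`)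
delivers it in the configuration form `ekHaar 2 n {U | ∃ R, rank R ≤ r ∧ frobSq (ekComm U 0 1 − R) ≤ σ}`; this file identifies the
two (and the same for any predicate of the two links).  ROUTE-INDEPENDENT.  Nothing here bears on the Yang–Mills mass gap. -/
import Literature.Barriers.QuantumFields.EguchiKawaiBreakdownLowerBound
import HarnessLib

/-!
# Route `EguchiKawaiDirectionLadder`: `ekHaar 2 n` events as Haar-pair events

* `ekHaar_two_setOf_eq_prod` — `ekHaar 2 n {U | Q (U 0) (U 1)} = (Haar ⊗ Haar) {p | Q p.1 p.2}` for EVERY predicate `Q` (the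
  measurable equivalence `finTwoArrow`; no measurability of the event is needed), and the preimage form `ekHaar_two_preimage_eq_prod`;
* `prod_setOf_eq_ekHaar_two` — the same read from the pair side: `(Haar ⊗ Haar) {p | Q p.1 p.2} = ekHaar 2 n {U | Q (U 0) (U 1)}`;
* `prod_rankRobustCommutator_eq_ekHaar_two` — the rank-robust commutator pair event:
  `(Haar ⊗ Haar){P | ∃ L, rank L ≤ r ∧ Σ_{ij}|(P₁P₂ − P₂P₁ − L)_{ij}|² ≤ σ} = ekHaar 2 n {U | ∃ R, rank R ≤ r ∧ frobSq (ekComm U 0 1 − R) ≤ σ}`,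
  and its slack-free twin `prod_commutator_eq_ekHaar_two`.

Combined with the re-indexing transport (`HaarReindex.haarPair_rankRobustCommutator_reindex`, block group `U({i // ℓ i = c}) ≃ U(Fin n_c)`)
this turns a `Ψ_rob` bound on `ekHaar 2 n_c` into the `h_Ψ` hypothesis of the decoupling inequality for block `c`, by rewriting.

HONEST FRAMING: measure-theoretic bookkeeping only.  The route bears on the barrier-ledger fact `EguchiKawaiBreakdown`; the
Yang–Mills mass gap is NOT touched.
-/

set_option autoImplicit false

noncomputable section

open MeasureTheory
open scoped Matrix ENNReal
open Literature.Barriers.QuantumFields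
open Literature.MathematicalPhysics.QuantumFieldTheory (haarProbability)

namespace Summit.QuantumFields.YangMills.Theorems.EguchiKawaiDirectionLadder

namespace PairLawBridge

variable {n : ℕ}

/-- `finTwoArrow : (Fin 2 → U(n)) ≃ᵐ U(n) × U(n)` carries `ekHaar 2 n` to `Haar ⊗ Haar`. -/
theorem measurePreserving_finTwoArrow_ekHaar :
    MeasurePreserving (MeasurableEquiv.finTwoArrow (α := UN n)) (ekHaar 2 n)
      ((haarProbability (UN n)).prod (haarProbability (UN n))) := by
  unfold ekHaar
  exact MeasureTheory.measurePreserving_finTwoArrow (haarProbability (UN n))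

/-- **Preimage form**: `ekHaar 2 n (finTwoArrow⁻¹' S) = (Haar ⊗ Haar) S` for EVERY set `S ⊆ U(n) × U(n)`. -/
theorem ekHaar_two_preimage_eq_prod (S : Set (UN n × UN n)) :
    ekHaar 2 n (MeasurableEquiv.finTwoArrow (α := UN n) ⁻¹' S) = ((haarProbability (UN n)).prod (haarProbability (UN n))) S :=
  measurePreserving_finTwoArrow_ekHaar.measure_preimage_equiv S

/-- **`ekHaar 2 n` events are Haar-pair events**: `ekHaar 2 n {U | Q (U 0) (U 1)} = (Haar ⊗ Haar) {p | Q p.1 p.2}` for every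
predicate `Q` of the two links. -/
theorem ekHaar_two_setOf_eq_prod (Q : UN n → UN n → Prop) :
    ekHaar 2 n {U : EKConfig 2 n | Q (U 0) (U 1)} = ((haarProbability (UN n)).prod (haarProbability (UN n))) {p | Q p.1 p.2} := by
  have h : {U : EKConfig 2 n | Q (U 0) (U 1)} = MeasurableEquiv.finTwoArrow (α := UN n) ⁻¹' {p | Q p.1 p.2} := by
    ext U
    simp only [Set.mem_setOf_eq, Set.mem_preimage, MeasurableEquiv.finTwoArrow_apply]
  rw [h, ekHaar_two_preimage_eq_prod]

/-- The same identity read from the pair side. -/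
theorem prod_setOf_eq_ekHaar_two (Q : UN n → UN n → Prop) :
    ((haarProbability (UN n)).prod (haarProbability (UN n))) {p | Q p.1 p.2} = ekHaar 2 n {U : EKConfig 2 n | Q (U 0) (U 1)} :=
  (ekHaar_two_setOf_eq_prod Q).symm

/-- The commutator of a two-link configuration is `U 0 · U 1 − U 1 · U 0`. -/
theorem ekComm_zero_one (U : EKConfig 2 n) :
    ekComm U 0 1 = (U 0 : Matrix (Fin n) (Fin n) ℂ) * (U 1 : Matrix (Fin n) (Fin n) ℂ) -
      (U 1 : Matrix (Fin n) (Fin n) ℂ) * (U 0 : Matrix (Fin n) (Fin n) ℂ) := rfl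

/-- `frobSq` is the explicit double sum `Σ_{ij} |M_{ij}|²`. -/
theorem frobSq_eq_sum (M : Matrix (Fin n) (Fin n) ℂ) : frobSq M = ∑ i, ∑ j, ‖M i j‖ ^ 2 := rfl

/-- **The rank-robust commutator pair event** (`h_Ψ` shape ↔ S8 shape):
`(Haar ⊗ Haar){P | ∃ L, rank L ≤ r ∧ Σ_{ij}|(P₁P₂ − P₂P₁ − L)_{ij}|² ≤ σ} = ekHaar 2 n {U | ∃ R, rank R ≤ r ∧ frobSq (ekComm U 0 1 − R) ≤ σ}`. -/
theorem prod_rankRobustCommutator_eq_ekHaar_two (r : ℕ) (σ : ℝ) :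
    ((haarProbability (UN n)).prod (haarProbability (UN n)))
        {P | ∃ L : Matrix (Fin n) (Fin n) ℂ, L.rank ≤ r ∧
          ∑ i, ∑ j, ‖((P.1 : Matrix (Fin n) (Fin n) ℂ) * (P.2 : Matrix (Fin n) (Fin n) ℂ) -
            (P.2 : Matrix (Fin n) (Fin n) ℂ) * (P.1 : Matrix (Fin n) (Fin n) ℂ) - L) i j‖ ^ 2 ≤ σ} =
      ekHaar 2 n {U : EKConfig 2 n | ∃ R : Matrix (Fin n) (Fin n) ℂ, R.rank ≤ r ∧ frobSq (ekComm U 0 1 - R) ≤ σ} := by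
  have h : {U : EKConfig 2 n | ∃ R : Matrix (Fin n) (Fin n) ℂ, R.rank ≤ r ∧ frobSq (ekComm U 0 1 - R) ≤ σ} =
      MeasurableEquiv.finTwoArrow (α := UN n) ⁻¹'
        {P | ∃ L : Matrix (Fin n) (Fin n) ℂ, L.rank ≤ r ∧
          ∑ i, ∑ j, ‖((P.1 : Matrix (Fin n) (Fin n) ℂ) * (P.2 : Matrix (Fin n) (Fin n) ℂ) -
            (P.2 : Matrix (Fin n) (Fin n) ℂ) * (P.1 : Matrix (Fin n) (Fin n) ℂ) - L) i j‖ ^ 2 ≤ σ} := by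
    ext U
    simp only [Set.mem_setOf_eq, Set.mem_preimage, MeasurableEquiv.finTwoArrow_apply, frobSq, ekComm]
  rw [h, ekHaar_two_preimage_eq_prod]

/-- The same with a real-valued rank bound (the shape `(rank : ℝ) ≤ b` used by `robustCommEvent`). -/
theorem prod_rankRobustCommutator_eq_ekHaar_two_real (b σ : ℝ) :
    ((haarProbability (UN n)).prod (haarProbability (UN n)))
        {P | ∃ L : Matrix (Fin n) (Fin n) ℂ, (L.rank : ℝ) ≤ b ∧
          ∑ i, ∑ j, ‖((P.1 : Matrix (Fin n) (Fin n) ℂ) * (P.2 : Matrix (Fin n) (Fin n) ℂ) -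
            (P.2 : Matrix (Fin n) (Fin n) ℂ) * (P.1 : Matrix (Fin n) (Fin n) ℂ) - L) i j‖ ^ 2 ≤ σ} =
      ekHaar 2 n {U : EKConfig 2 n | ∃ R : Matrix (Fin n) (Fin n) ℂ, (R.rank : ℝ) ≤ b ∧ frobSq (ekComm U 0 1 - R) ≤ σ} := by
  have h : {U : EKConfig 2 n | ∃ R : Matrix (Fin n) (Fin n) ℂ, (R.rank : ℝ) ≤ b ∧ frobSq (ekComm U 0 1 - R) ≤ σ} =
      MeasurableEquiv.finTwoArrow (α := UN n) ⁻¹'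
        {P | ∃ L : Matrix (Fin n) (Fin n) ℂ, (L.rank : ℝ) ≤ b ∧
          ∑ i, ∑ j, ‖((P.1 : Matrix (Fin n) (Fin n) ℂ) * (P.2 : Matrix (Fin n) (Fin n) ℂ) -
            (P.2 : Matrix (Fin n) (Fin n) ℂ) * (P.1 : Matrix (Fin n) (Fin n) ℂ) - L) i j‖ ^ 2 ≤ σ} := by
    ext U
    simp only [Set.mem_setOf_eq, Set.mem_preimage, MeasurableEquiv.finTwoArrow_apply, frobSq, ekComm]
  rw [h, ekHaar_two_preimage_eq_prod]

/-- **The plain commutator pair event** (`Ψ` shape):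
`(Haar ⊗ Haar){P | Σ_{ij}|(P₁P₂ − P₂P₁)_{ij}|² ≤ σ} = ekHaar 2 n {U | frobSq (ekComm U 0 1) ≤ σ}`. -/
theorem prod_commutator_eq_ekHaar_two (σ : ℝ) :
    ((haarProbability (UN n)).prod (haarProbability (UN n)))
        {P | ∑ i, ∑ j, ‖((P.1 : Matrix (Fin n) (Fin n) ℂ) * (P.2 : Matrix (Fin n) (Fin n) ℂ) -
            (P.2 : Matrix (Fin n) (Fin n) ℂ) * (P.1 : Matrix (Fin n) (Fin n) ℂ)) i j‖ ^ 2 ≤ σ} =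
      ekHaar 2 n {U : EKConfig 2 n | frobSq (ekComm U 0 1) ≤ σ} := by
  have h : {U : EKConfig 2 n | frobSq (ekComm U 0 1) ≤ σ} =
      MeasurableEquiv.finTwoArrow (α := UN n) ⁻¹'
        {P | ∑ i, ∑ j, ‖((P.1 : Matrix (Fin n) (Fin n) ℂ) * (P.2 : Matrix (Fin n) (Fin n) ℂ) -
            (P.2 : Matrix (Fin n) (Fin n) ℂ) * (P.1 : Matrix (Fin n) (Fin n) ℂ)) i j‖ ^ 2 ≤ σ} := by
    ext U
    simp only [Set.mem_setOf_eq, Set.mem_preimage, MeasurableEquiv.finTwoArrow_apply, frobSq, ekComm]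
  rw [h, ekHaar_two_preimage_eq_prod]

/-- **The reduced-action pair event**: `(Haar ⊗ Haar){p | S_R(![p.1, p.2]) ≤ t} = ekHaar 2 n {U | S_R(U) ≤ t}`. -/
theorem prod_ekAction_eq_ekHaar_two (t : ℝ) :
    ((haarProbability (UN n)).prod (haarProbability (UN n))) {p | ekAction ((![p.1, p.2] : EKConfig 2 n)) ≤ t} =
      ekHaar 2 n {U : EKConfig 2 n | ekAction U ≤ t} := by
  have hU : ∀ U : EKConfig 2 n, (![U 0, U 1] : EKConfig 2 n) = U := fun U => by
    funext i
    fin_cases i <;> rfl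
  have h : {U : EKConfig 2 n | ekAction U ≤ t} =
      MeasurableEquiv.finTwoArrow (α := UN n) ⁻¹' {p | ekAction ((![p.1, p.2] : EKConfig 2 n)) ≤ t} := by
    ext U
    simp only [Set.mem_setOf_eq, Set.mem_preimage, MeasurableEquiv.finTwoArrow_apply, hU]
  rw [h, ekHaar_two_preimage_eq_prod]

end PairLawBridge

end Summit.QuantumFields.YangMills.Theorems.EguchiKawaiDirectionLadder

end
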